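import Mathlib
import Literature.NumberTheory.Transcendental.PkappaThetaTangent
import Summits.KontsevichZagierPeriods.KontsevichZagierPeriods.Theorems.InverseLandauTateFamilyKernelRationalCertificate
import Summits.KontsevichZagierPeriods.KontsevichZagierPeriods.Theorems.InverseLandauTateFamilyKernelGapInstance

/-!
# `TateFamilyKernel` — rule (2) along a polynomial isotopy of the square is an `m = 1` Ayoub
# certificate (line `Sketch`, stub `stub_isotopyTwo`)

Crux `TateFamilyKernel` (stmt-KontsevichZagierPeriods-9130, route `InverseLandau`), line `Sketch`.
Data: the components `φ₁, φ₂ ∈ ℚ[w₀, w₁, s, ϖ]` (variables `X 0, X 1, X 2, X 3`) of a polynomial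
family `Φ_s = (φ₁, φ₂)` of self-maps of the square sending each edge into an edge of the same
direction (`φ₁ ≡ c₁₀` on `w₀ = 0`, `φ₁ ≡ c₁₁` on `w₀ = 1`, `φ₂ ≡ c₂₀` on `w₁ = 0`, `φ₂ ≡ c₂₁` on
`w₁ = 1`), a rational `h = B/E ∈ ℚ(y₀, y₁, ϖ)`, and a real-algebraic `ϖ₀` with `E(Φ_s(w), ϖ₀) ≠ 0`
on the closed cube `[0,1]³`. Conclusion (`stub_isotopyTwo`): every tame cube representation of
`f(z) = h(Φ₁ z)·J₁(z) − h(Φ₀ z)·J₀(z)`, `J = ∂₀φ₁∂₁φ₂ − ∂₁φ₁∂₀φ₂` (everything at `ϖ₀`), lies in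
`KZ.relations` — so one rule-(2) move along an isotopy is a kind-(a) element of the line's descent
normal form with ONE auxiliary cube variable.

Proof. With `hΦ = (B/E)∘Φ`, `K₀ = −hΦ(∂₁φ₁∂_sφ₂ − ∂_sφ₁∂₁φ₂)`, `K₁ = hΦ(∂₀φ₁∂_sφ₂ − ∂_sφ₁∂₀φ₂)` the
TRANSPORT IDENTITY `∂₀K₀ + ∂₁K₁ = ∂_s(hΦ·J)` holds (it is `d Φ^*(h dy₀ ∧ dy₁) = 0` on
`(w₀, w₁, s)`-space: the formal chain rule `pderiv_bind₁` plus `ring`, `Iso.transport`); the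
edge conditions make `K₀` vanish on `w₀ ∈ {0,1}` and `K₁` on `w₁ ∈ {0,1}`; hence pointwise on
`[0,1]³` `f(w₀,w₁) = relA₀(K₀) + relA₁(K₁) + relA_s(−hΦ·J)`, a three-term instance of
`tame_certificate` (p111085) with `n = 2`, `m = 1` and rational data of common denominator `E∘Φ`.
References: Kontsevich–Zagier 2001 §1.2 rules (2), (3); Ayoub, EMS Newsl. 91 (2014) Def. 10.
-/

noncomputable section

open MeasureTheory Set MvPolynomial
open Literature.NumberTheory.Transcendental
open Literature.ModelTheory.ExponentialFields (IsSemialgebraic analyticOnNhd_aeval)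

namespace Summit.KontsevichZagierPeriods.InverseLandau.TateFamilyKernel.Descent

namespace Iso

/-! ### Formal calculus: commuting partials, the chain rule for `Φ`, the transport identity -/

/-- Mixed formal partial derivatives commute, `∂ᵢ∂ⱼ = ∂ⱼ∂ᵢ`, on `ℚ[w₀, w₁, s, ϖ]` (the case used
here of the folklore fact; over `ℝ` it is `Literature.Algebra.Polynomial.pderiv_pderiv_comm`).
[folklore] -/
theorem pderiv_pderiv_comm (i j : Fin (2 + 1 + 1)) (p : MvPolynomial (Fin (2 + 1 + 1)) ℚ) :
    pderiv i (pderiv j p) = pderiv j (pderiv i p) := by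
  -- adapted from `Literature.Algebra.Polynomial.pderiv_pderiv_comm` (FischerInnerProduct)
  induction p using MvPolynomial.induction_on with
  | C a => simp
  | add p q hp hq => simp [map_add, hp, hq]
  | mul_X p k h =>
    simp only [pderiv_mul, map_add, h, pderiv_X]
    by_cases hik : i = k <;> by_cases hjk : j = k <;> simp [hik, hjk]

/-- The chain rule for the substitution `y₀ ↦ φ₁, y₁ ↦ φ₂, ϖ ↦ ϖ` along a cube direction `i ≠ 3`
(the parameter `ϖ = X 3` is not differentiated):
`∂ᵢ(P∘Φ) = (∂₀P∘Φ)·∂ᵢφ₁ + (∂₁P∘Φ)·∂ᵢφ₂` — the formal chain rule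
`Literature.NumberTheory.Transcendental.pderiv_bind₁`. [folklore] -/
theorem pderiv_bind₁_three (φ₁ φ₂ : MvPolynomial (Fin (2 + 1 + 1)) ℚ)
    (P : MvPolynomial (Fin (2 + 1)) ℚ) {i : Fin (2 + 1 + 1)} (hi : (3 : Fin (2 + 1 + 1)) ≠ i) :
    pderiv i (bind₁ ![φ₁, φ₂, X 3] P) =
      bind₁ ![φ₁, φ₂, X 3] (pderiv 0 P) * pderiv i φ₁ +
        bind₁ ![φ₁, φ₂, X 3] (pderiv 1 P) * pderiv i φ₂ := by
  rw [pderiv_bind₁, Fin.sum_univ_three]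
  simp only [Matrix.cons_val_zero, Matrix.cons_val_one, Matrix.cons_val_two, Matrix.head_cons,
    Matrix.tail_cons, pderiv_X_of_ne hi, mul_zero, add_zero]

/-- **The transport identity** `∂₀K₀ + ∂₁K₁ = ∂_s(hΦ·J)` cleared of denominators: with
`K₀ = −hΦ(∂₁φ₁∂₂φ₂ − ∂₂φ₁∂₁φ₂)`, `K₁ = hΦ(∂₀φ₁∂₂φ₂ − ∂₂φ₁∂₀φ₂)`, `J = ∂₀φ₁∂₁φ₂ − ∂₁φ₁∂₀φ₂`,
`hΦ = BΦ/EΦ` and the chain rules `∂ᵢBΦ = B₀∂ᵢφ₁ + B₁∂ᵢφ₂`, `∂ᵢEΦ = E₀∂ᵢφ₁ + E₁∂ᵢφ₂` (`i = 0, 1, 2`),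
the three quotient-rule numerators of `∂₀K₀`, `∂₁K₁`, `∂₂(−hΦ·J)` sum to zero — it is
`d(Φ^*(h dy₀ ∧ dy₁)) = Φ^* d(h dy₀ ∧ dy₁) = 0` on `(w₀, w₁, s)`-space. [folklore] -/
theorem transport {φ₁ φ₂ BΦ EΦ B₀ B₁ E₀ E₁ : MvPolynomial (Fin (2 + 1 + 1)) ℚ}
    (hB : ∀ i : Fin (2 + 1 + 1), (3 : Fin (2 + 1 + 1)) ≠ i →
      pderiv i BΦ = B₀ * pderiv i φ₁ + B₁ * pderiv i φ₂)
    (hE : ∀ i : Fin (2 + 1 + 1), (3 : Fin (2 + 1 + 1)) ≠ i →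
      pderiv i EΦ = E₀ * pderiv i φ₁ + E₁ * pderiv i φ₂) :
    pderiv 0 (-(BΦ * (pderiv 1 φ₁ * pderiv 2 φ₂ - pderiv 2 φ₁ * pderiv 1 φ₂))) * EΦ -
        (-(BΦ * (pderiv 1 φ₁ * pderiv 2 φ₂ - pderiv 2 φ₁ * pderiv 1 φ₂))) * pderiv 0 EΦ +
      (pderiv 1 (BΦ * (pderiv 0 φ₁ * pderiv 2 φ₂ - pderiv 2 φ₁ * pderiv 0 φ₂)) * EΦ -
        (BΦ * (pderiv 0 φ₁ * pderiv 2 φ₂ - pderiv 2 φ₁ * pderiv 0 φ₂)) * pderiv 1 EΦ) +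
      (pderiv 2 (-(BΦ * (pderiv 0 φ₁ * pderiv 1 φ₂ - pderiv 1 φ₁ * pderiv 0 φ₂))) * EΦ -
        (-(BΦ * (pderiv 0 φ₁ * pderiv 1 φ₂ - pderiv 1 φ₁ * pderiv 0 φ₂))) * pderiv 2 EΦ) = 0 := by
  have h0 : (3 : Fin (2 + 1 + 1)) ≠ 0 := by decide
  have h1 : (3 : Fin (2 + 1 + 1)) ≠ 1 := by decide
  have h2 : (3 : Fin (2 + 1 + 1)) ≠ 2 := by decide
  simp only [map_neg, map_sub, pderiv_mul, hB 0 h0, hB 1 h1, hB 2 h2, hE 0 h0, hE 1 h1, hE 2 h2,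
    pderiv_pderiv_comm 1 0, pderiv_pderiv_comm 2 0, pderiv_pderiv_comm 2 1]
  ring

/-- On a face where `φ = c + L·R` with `L` vanishing there and `∂ⱼL = 0`, the tangential derivative
`∂ⱼφ` vanishes. [folklore] -/
theorem aeval_pderiv_eq_zero_of_eq {N : ℕ} {φ L R : MvPolynomial (Fin N) ℚ} {c : ℚ} {j : Fin N}
    (hφ : φ = C c + L * R) (hL : pderiv j L = 0) {v : Fin N → ℝ} (hv : aeval v L = 0) :
    aeval v (pderiv j φ) = 0 := by
  rw [hφ, map_add, pderiv_C, pderiv_mul, hL, zero_mul, zero_add, zero_add, map_mul, hv, zero_mul]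

/-! ### The double slice `z ↦ (z, c, ϖ₀)` -/

/-- Reading `(w₀, w₁, c, ϖ₀)` either as the slice at `ϖ₀` of `w` with `s` frozen at `c`, or as the
double slice of `z = (w₀, w₁)`. [folklore] -/
theorem snoc_update_two (w : Fin (2 + 1) → ℝ) (c ϖ₀ : ℝ) :
    (Fin.snoc (Function.update w 2 c) ϖ₀ : Fin (2 + 1 + 1) → ℝ) =
      Fin.snoc (Fin.snoc (fun j : Fin 2 => w (Fin.castAdd 1 j)) c : Fin (2 + 1) → ℝ) ϖ₀ := by
  congr 1
  ext j
  refine Fin.lastCases ?_ (fun i => ?_) j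
  · rw [Fin.snoc_last]
    exact Function.update_self ..
  · have hi : Fin.castSucc i ≠ (2 : Fin (2 + 1)) := ne_of_lt (Fin.castSucc_lt_last i)
    rw [Fin.snoc_castSucc, Function.update_of_ne hi]
    rfl

/-- The double slice map `z ↦ (z, c, ϖ₀)` is affine, hence analytic. [folklore] -/
theorem analyticAt_snoc_snoc {n : ℕ} (c ϖ₀ : ℝ) (z : Fin n → ℝ) :
    AnalyticAt ℝ (fun z : Fin n → ℝ =>
      (Fin.snoc (Fin.snoc z c : Fin (n + 1) → ℝ) ϖ₀ : Fin (n + 1 + 1) → ℝ)) z := by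
  have h1 : ∀ (m : ℕ) (a : ℝ) (x : Fin m → ℝ),
      AnalyticAt ℝ (fun x : Fin m → ℝ => (Fin.snoc x a : Fin (m + 1) → ℝ)) x := by
    intro m a x
    obtain ⟨L, hL⟩ : ∃ L : (Fin m → ℝ) →L[ℝ] (Fin (m + 1) → ℝ), ∀ y : Fin m → ℝ,
        (Fin.snoc y a : Fin (m + 1) → ℝ) = L y + Fin.snoc (0 : Fin m → ℝ) a :=
      ⟨_, fun y => snoc_eq_clm_add a y⟩
    rw [show (fun y : Fin m → ℝ => (Fin.snoc y a : Fin (m + 1) → ℝ)) =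
      fun y => L y + Fin.snoc (0 : Fin m → ℝ) a from funext hL]
    exact (L.analyticAt x).add analyticAt_const
  exact (h1 (n + 1) ϖ₀ _).comp (h1 n c z)

/-- A ratio of `ℚ`-polynomials double-sliced at `(c, ϖ₀)` is analytic wherever the denominator does
not vanish. [folklore] -/
theorem analyticAt_aeval_div_aeval_snoc_snoc {n : ℕ} (c ϖ₀ : ℝ)
    (P Q : MvPolynomial (Fin (n + 1 + 1)) ℚ) {z : Fin n → ℝ}
    (hQ : aeval (Fin.snoc (Fin.snoc z c : Fin (n + 1) → ℝ) ϖ₀ : Fin (n + 1 + 1) → ℝ) Q ≠ 0) :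
    AnalyticAt ℝ (fun z : Fin n → ℝ =>
      aeval (Fin.snoc (Fin.snoc z c : Fin (n + 1) → ℝ) ϖ₀ : Fin (n + 1 + 1) → ℝ) P /
        aeval (Fin.snoc (Fin.snoc z c : Fin (n + 1) → ℝ) ϖ₀ : Fin (n + 1 + 1) → ℝ) Q) z :=
  (((analyticOnNhd_aeval P) _ (mem_univ _)).comp (analyticAt_snoc_snoc c ϖ₀ z)).div
    (((analyticOnNhd_aeval Q) _ (mem_univ _)).comp (analyticAt_snoc_snoc c ϖ₀ z)) hQ

/-- The double slice map `z ↦ (z, c, ϖ₀)` is `ℚ`-semialgebraic for real-algebraic `c`, `ϖ₀`.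
[cite: BochnakCosteRoy1998, §2.2] -/
theorem isSemialgebraicMapOn_snoc_snoc {n : ℕ} {s : Set (Fin n → ℝ)} (hs : IsSemialgebraic ℚ s)
    {c ϖ₀ : ℝ} (hc : IsAlgebraic ℚ c) (hϖ₀ : IsAlgebraic ℚ ϖ₀) :
    IsSemialgebraicMapOn ℚ s (fun z : Fin n → ℝ =>
      (Fin.snoc (Fin.snoc z c : Fin (n + 1) → ℝ) ϖ₀ : Fin (n + 1 + 1) → ℝ)) := by
  refine IsSemialgebraicMapOn.of_forall hs fun j => ?_
  refine Fin.lastCases ?_ (fun i => ?_) j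
  · simpa using isSemialgebraicFunOn_const_of_isAlgebraic hs hϖ₀
  · refine Fin.lastCases ?_ (fun i' => ?_) i
    · simpa using isSemialgebraicFunOn_const_of_isAlgebraic hs hc
    · simpa using isSemialgebraicFunOn_apply hs i'

end Iso

open Iso in
/-- STUB `stub_isotopyTwo` of line `Sketch` — **rule (2) along a polynomial ISOTOPY is an `m = 1`
Ayoub certificate, dimension 2.** Data: the components `φ₁, φ₂ ∈ ℚ[w₀, w₁, s, ϖ]` of a polynomial
family `Φ_s = (φ₁, φ₂)` of self-maps of the square which sends each edge into an edge of the same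
direction (`φ₁ ≡ c₁₀` on `w₀ = 0`, `φ₁ ≡ c₁₁` on `w₀ = 1`, `φ₂ ≡ c₂₀` on `w₁ = 0`, `φ₂ ≡ c₂₁` on
`w₁ = 1`, stated as divisibilities), and `h = B/E ∈ ℚ(y₀, y₁, ϖ)` with `E(Φ_s(w), ϖ₀) ≠ 0` on
`[0,1]³` (`w = (w₀, w₁, s)`, `ϖ₀` real algebraic). Conclusion: every tame cube representation of
`f(z) = h(Φ₁ z)·J₁(z) − h(Φ₀ z)·J₀(z)` (`J_s = ∂₀φ₁∂₁φ₂ − ∂₁φ₁∂₀φ₂`, everything at `ϖ₀`) is a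
relation.
Proof: the transport identity `∂_s(h(Φ)J) = ∂₀K₀ + ∂₁K₁` (`Iso.transport`) with
`K₀ = −h(Φ)(∂₁φ₁∂_sφ₂ − ∂_sφ₁∂₁φ₂)`, `K₁ = h(Φ)(∂₀φ₁∂_sφ₂ − ∂_sφ₁∂₀φ₂)`, the face conditions
`K₀|_{w₀∈{0,1}} = 0`, `K₁|_{w₁∈{0,1}} = 0`, hence on `[0,1]³`
`f(z) = relA₀(K₀) + relA₁(K₁) + relA_s(−h(Φ)J)` — `tame_certificate` (p111085) with `n = 2`,
`m = 1`, three terms, rational data with denominator `E∘Φ`.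
[cite: KontsevichZagier2001, §1.2 rules (2), (3)] [cite: Ayoub2014, Def. 10] -/
theorem stub_isotopyTwo (φ₁ φ₂ : MvPolynomial (Fin (2 + 1 + 1)) ℚ) (B E : MvPolynomial (Fin (2 + 1)) ℚ)
    (c₁₀ c₁₁ c₂₀ c₂₁ : ℚ)
    (h10 : ∃ R₁ : MvPolynomial (Fin (2 + 1 + 1)) ℚ, φ₁ = C c₁₀ + X 0 * R₁)
    (h11 : ∃ R₁ : MvPolynomial (Fin (2 + 1 + 1)) ℚ, φ₁ = C c₁₁ + (1 - X 0) * R₁)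
    (h20 : ∃ R₂ : MvPolynomial (Fin (2 + 1 + 1)) ℚ, φ₂ = C c₂₀ + X 1 * R₂)
    (h21 : ∃ R₂ : MvPolynomial (Fin (2 + 1 + 1)) ℚ, φ₂ = C c₂₁ + (1 - X 1) * R₂)
    (ϖ₀ : ℝ) (halg : IsAlgebraic ℚ ϖ₀)
    (hE : ∀ w ∈ KZ.cube (2 + 1), aeval (Fin.snoc w ϖ₀ : Fin (2 + 1 + 1) → ℝ)
      (bind₁ ![φ₁, φ₂, X 3] E) ≠ 0) :
    ∀ R : KZ.IntegralRep 2, R.IsTameCube →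
      (∀ z ∈ KZ.cube 2, R.integrand z =
        aeval (Fin.snoc (Fin.snoc z 1) ϖ₀ : Fin (2 + 1 + 1) → ℝ) (bind₁ ![φ₁, φ₂, X 3] B) /
              aeval (Fin.snoc (Fin.snoc z 1) ϖ₀ : Fin (2 + 1 + 1) → ℝ) (bind₁ ![φ₁, φ₂, X 3] E) *
            aeval (Fin.snoc (Fin.snoc z 1) ϖ₀ : Fin (2 + 1 + 1) → ℝ)
              (pderiv 0 φ₁ * pderiv 1 φ₂ - pderiv 1 φ₁ * pderiv 0 φ₂) -
          aeval (Fin.snoc (Fin.snoc z 0) ϖ₀ : Fin (2 + 1 + 1) → ℝ) (bind₁ ![φ₁, φ₂, X 3] B) /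
              aeval (Fin.snoc (Fin.snoc z 0) ϖ₀ : Fin (2 + 1 + 1) → ℝ) (bind₁ ![φ₁, φ₂, X 3] E) *
            aeval (Fin.snoc (Fin.snoc z 0) ϖ₀ : Fin (2 + 1 + 1) → ℝ)
              (pderiv 0 φ₁ * pderiv 1 φ₂ - pderiv 1 φ₁ * pderiv 0 φ₂)) →
      KZ.of R ∈ KZ.relations := by
  intro R hR hRi
  obtain ⟨P₁, hP₁⟩ := h10
  obtain ⟨P₁', hP₁'⟩ := h11
  obtain ⟨P₂, hP₂⟩ := h20
  obtain ⟨P₂', hP₂'⟩ := h21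
  -- the transport identity for the substituted numerator and denominator `B∘Φ`, `E∘Φ`
  have key := transport (φ₁ := φ₁) (φ₂ := φ₂)
    (fun i hi => pderiv_bind₁_three φ₁ φ₂ B hi) (fun i hi => pderiv_bind₁_three φ₁ φ₂ E hi)
  -- names for the certificate data (`X 0 = w₀`, `X 1 = w₁`, `X 2 = s`, `X 3 = ϖ`)
  set EΦ : MvPolynomial (Fin (2 + 1 + 1)) ℚ := bind₁ ![φ₁, φ₂, X 3] E with hEΦ
  set BΦ : MvPolynomial (Fin (2 + 1 + 1)) ℚ := bind₁ ![φ₁, φ₂, X 3] B with hBΦ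
  set A₀ : MvPolynomial (Fin (2 + 1 + 1)) ℚ :=
    -(BΦ * (pderiv 1 φ₁ * pderiv 2 φ₂ - pderiv 2 φ₁ * pderiv 1 φ₂)) with hA₀
  set A₁ : MvPolynomial (Fin (2 + 1 + 1)) ℚ :=
    BΦ * (pderiv 0 φ₁ * pderiv 2 φ₂ - pderiv 2 φ₁ * pderiv 0 φ₂) with hA₁
  set A₂ : MvPolynomial (Fin (2 + 1 + 1)) ℚ :=
    -(BΦ * (pderiv 0 φ₁ * pderiv 1 φ₂ - pderiv 1 φ₁ * pderiv 0 φ₂)) with hA₂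
  -- the common denominator `E∘Φ` does not vanish on the closed cube, nor on its `s`-faces
  have hE2 : ∀ w ∈ KZ.cube (2 + 1), aeval (Fin.snoc w ϖ₀ : Fin (2 + 1 + 1) → ℝ) (EΦ ^ 2) ≠ 0 :=
    fun w hw => by rw [map_pow]; exact pow_ne_zero 2 (hE w hw)
  have hEc : ∀ c ∈ Icc (0 : ℝ) 1, ∀ z ∈ KZ.cube 2,
      aeval (Fin.snoc (Fin.snoc z c : Fin (2 + 1) → ℝ) ϖ₀ : Fin (2 + 1 + 1) → ℝ) EΦ ≠ 0 :=
    fun c hc z hz => hE _ (KZ.snoc_mem_cube_iff.2 ⟨hz, hc.1, hc.2⟩)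
  have h0m : (0 : ℝ) ∈ Icc (0 : ℝ) 1 := ⟨le_rfl, zero_le_one⟩
  have h1m : (1 : ℝ) ∈ Icc (0 : ℝ) 1 := ⟨zero_le_one, le_rfl⟩
  have hc2 : (Fin.castSucc (2 : Fin (2 + 1)) : Fin (2 + 1 + 1)) = 2 := rfl
  -- face vanishing of `K₀ = A₀/EΦ` on `w₀ ∈ {0,1}` and of `K₁ = A₁/EΦ` on `w₁ ∈ {0,1}`
  have hA₀v : ∀ v : Fin (2 + 1 + 1) → ℝ, aeval v (pderiv 1 φ₁) = 0 → aeval v (pderiv 2 φ₁) = 0 →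
      aeval v A₀ = 0 := fun v h1 h2 => by
    simp only [hA₀, map_neg, map_mul, map_sub, h1, h2, zero_mul, sub_zero, mul_zero, neg_zero]
  have hA₁v : ∀ v : Fin (2 + 1 + 1) → ℝ, aeval v (pderiv 0 φ₂) = 0 → aeval v (pderiv 2 φ₂) = 0 →
      aeval v A₁ = 0 := fun v h1 h2 => by
    simp only [hA₁, map_mul, map_sub, h1, h2, mul_zero, sub_zero]
  have hd10 : pderiv (1 : Fin (2 + 1 + 1)) (X 0 : MvPolynomial (Fin (2 + 1 + 1)) ℚ) = 0 :=
    pderiv_X_of_ne (by decide)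
  have hd20 : pderiv (2 : Fin (2 + 1 + 1)) (X 0 : MvPolynomial (Fin (2 + 1 + 1)) ℚ) = 0 :=
    pderiv_X_of_ne (by decide)
  have hd01 : pderiv (0 : Fin (2 + 1 + 1)) (X 1 : MvPolynomial (Fin (2 + 1 + 1)) ℚ) = 0 :=
    pderiv_X_of_ne (by decide)
  have hd21 : pderiv (2 : Fin (2 + 1 + 1)) (X 1 : MvPolynomial (Fin (2 + 1 + 1)) ℚ) = 0 :=
    pderiv_X_of_ne (by decide)
  have hd10' : pderiv (1 : Fin (2 + 1 + 1)) (1 - X 0 : MvPolynomial (Fin (2 + 1 + 1)) ℚ) = 0 := by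
    rw [map_sub, pderiv_one, hd10, sub_zero]
  have hd20' : pderiv (2 : Fin (2 + 1 + 1)) (1 - X 0 : MvPolynomial (Fin (2 + 1 + 1)) ℚ) = 0 := by
    rw [map_sub, pderiv_one, hd20, sub_zero]
  have hd01' : pderiv (0 : Fin (2 + 1 + 1)) (1 - X 1 : MvPolynomial (Fin (2 + 1 + 1)) ℚ) = 0 := by
    rw [map_sub, pderiv_one, hd01, sub_zero]
  have hd21' : pderiv (2 : Fin (2 + 1 + 1)) (1 - X 1 : MvPolynomial (Fin (2 + 1 + 1)) ℚ) = 0 := by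
    rw [map_sub, pderiv_one, hd21, sub_zero]
  refine tame_certificate (n := 2) (m := 1) (Finset.univ : Finset (Fin 3))
    (![0, 1, 2] : Fin 3 → Fin (2 + 1))
    (f := fun z : Fin 2 → ℝ =>
      aeval (Fin.snoc (Fin.snoc z 0 : Fin (2 + 1) → ℝ) ϖ₀ : Fin (2 + 1 + 1) → ℝ) A₂ /
          aeval (Fin.snoc (Fin.snoc z 0 : Fin (2 + 1) → ℝ) ϖ₀ : Fin (2 + 1 + 1) → ℝ) EΦ -
        aeval (Fin.snoc (Fin.snoc z 1 : Fin (2 + 1) → ℝ) ϖ₀ : Fin (2 + 1 + 1) → ℝ) A₂ /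
          aeval (Fin.snoc (Fin.snoc z 1 : Fin (2 + 1) → ℝ) ϖ₀ : Fin (2 + 1 + 1) → ℝ) EΦ)
    (fun z hz => (analyticAt_aeval_div_aeval_snoc_snoc 0 ϖ₀ A₂ EΦ (hEc 0 h0m z hz)).sub
      (analyticAt_aeval_div_aeval_snoc_snoc 1 ϖ₀ A₂ EΦ (hEc 1 h1m z hz)))
    (IsSemialgebraicFunOn.sub_holds
      (isSemialgebraicFunOn_aeval_div_aeval_comp
        (isSemialgebraicMapOn_snoc_snoc KZ.isSemialgebraic_cube isAlgebraic_zero halg) A₂ EΦ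
        (hEc 0 h0m))
      (isSemialgebraicFunOn_aeval_div_aeval_comp
        (isSemialgebraicMapOn_snoc_snoc KZ.isSemialgebraic_cube isAlgebraic_one halg) A₂ EΦ
        (hEc 1 h1m)))
    (G := fun k w => aeval (Fin.snoc w ϖ₀ : Fin (2 + 1 + 1) → ℝ) ((![A₀, A₁, A₂] : Fin 3 → _) k) /
      aeval (Fin.snoc w ϖ₀ : Fin (2 + 1 + 1) → ℝ) EΦ)
    (G' := fun k w => aeval (Fin.snoc w ϖ₀ : Fin (2 + 1 + 1) → ℝ)
        (pderiv (Fin.castSucc ((![0, 1, 2] : Fin 3 → Fin (2 + 1)) k))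
            ((![A₀, A₁, A₂] : Fin 3 → _) k) * EΦ -
          (![A₀, A₁, A₂] : Fin 3 → _) k *
            pderiv (Fin.castSucc ((![0, 1, 2] : Fin 3 → Fin (2 + 1)) k)) EΦ) /
      aeval (Fin.snoc w ϖ₀ : Fin (2 + 1 + 1) → ℝ) (EΦ ^ 2))
    (fun k _ => analyticOnNhd_slice _ EΦ ϖ₀ hE)
    (fun k _ => isSemialgebraicFunOn_slice _ EΦ halg hE)
    (fun k _ => analyticOnNhd_slice _ _ ϖ₀ hE2)
    (fun k _ => isSemialgebraicFunOn_slice _ _ halg hE2)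
    (fun k _ w hw => hasDerivAt_slice_update _ EΦ ϖ₀ _ w (hE w hw))
    (fun w hw => ?_) R hR (fun z hz => ?_)
  · -- the pointwise certificate identity on `[0,1]³`
    simp only [Fin.sum_univ_three, Matrix.cons_val_zero, Matrix.cons_val_one, Matrix.cons_val_two,
      Matrix.head_cons, Matrix.tail_cons, Fin.castSucc_zero, Fin.castSucc_one, hc2]
    -- the faces `w₀ ∈ {0,1}` of `K₀` and `w₁ ∈ {0,1}` of `K₁` vanish
    have f00 : aeval (Fin.snoc (Function.update w 0 0) ϖ₀ : Fin (2 + 1 + 1) → ℝ) A₀ = 0 :=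
      hA₀v _
        (aeval_pderiv_eq_zero_of_eq hP₁ hd10 (by rw [aeval_X, Gap.snoc4_0, Function.update_self]))
        (aeval_pderiv_eq_zero_of_eq hP₁ hd20 (by rw [aeval_X, Gap.snoc4_0, Function.update_self]))
    have f01 : aeval (Fin.snoc (Function.update w 0 1) ϖ₀ : Fin (2 + 1 + 1) → ℝ) A₀ = 0 :=
      hA₀v _ (aeval_pderiv_eq_zero_of_eq hP₁' hd10'
          (by rw [map_sub, map_one, aeval_X, Gap.snoc4_0, Function.update_self, sub_self]))
        (aeval_pderiv_eq_zero_of_eq hP₁' hd20'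
          (by rw [map_sub, map_one, aeval_X, Gap.snoc4_0, Function.update_self, sub_self]))
    have f10 : aeval (Fin.snoc (Function.update w 1 0) ϖ₀ : Fin (2 + 1 + 1) → ℝ) A₁ = 0 :=
      hA₁v _
        (aeval_pderiv_eq_zero_of_eq hP₂ hd01 (by rw [aeval_X, Gap.snoc4_1, Function.update_self]))
        (aeval_pderiv_eq_zero_of_eq hP₂ hd21 (by rw [aeval_X, Gap.snoc4_1, Function.update_self]))
    have f11 : aeval (Fin.snoc (Function.update w 1 1) ϖ₀ : Fin (2 + 1 + 1) → ℝ) A₁ = 0 :=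
      hA₁v _ (aeval_pderiv_eq_zero_of_eq hP₂' hd01'
          (by rw [map_sub, map_one, aeval_X, Gap.snoc4_1, Function.update_self, sub_self]))
        (aeval_pderiv_eq_zero_of_eq hP₂' hd21'
          (by rw [map_sub, map_one, aeval_X, Gap.snoc4_1, Function.update_self, sub_self]))
    rw [f00, f01, f10, f11, zero_div, zero_div]
    -- the derivative parts sum to zero by the transport identity
    have hsum : aeval (Fin.snoc w ϖ₀ : Fin (2 + 1 + 1) → ℝ) (pderiv 0 A₀ * EΦ - A₀ * pderiv 0 EΦ) /
          aeval (Fin.snoc w ϖ₀ : Fin (2 + 1 + 1) → ℝ) (EΦ ^ 2) +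
        aeval (Fin.snoc w ϖ₀ : Fin (2 + 1 + 1) → ℝ) (pderiv 1 A₁ * EΦ - A₁ * pderiv 1 EΦ) /
          aeval (Fin.snoc w ϖ₀ : Fin (2 + 1 + 1) → ℝ) (EΦ ^ 2) +
        aeval (Fin.snoc w ϖ₀ : Fin (2 + 1 + 1) → ℝ) (pderiv 2 A₂ * EΦ - A₂ * pderiv 2 EΦ) /
          aeval (Fin.snoc w ϖ₀ : Fin (2 + 1 + 1) → ℝ) (EΦ ^ 2) = 0 := by
      rw [← add_div, ← add_div, ← map_add, ← map_add, key, map_zero, zero_div]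
    -- the `s`-faces of `−hΦ·J = A₂/EΦ` are the two terms of `f`
    rw [snoc_update_two w 1 ϖ₀, snoc_update_two w 0 ϖ₀]
    linear_combination -hsum
  · -- the integrand is `f`
    rw [hRi z hz]
    simp only [hA₂, map_neg, map_mul]
    ring

end Summit.KontsevichZagierPeriods.InverseLandau.TateFamilyKernel.Descent
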